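import Mathlib.LinearAlgebra.Span.Basic
import Literature.AlgebraicTopology.SingularHomology.SingularCochains
import Literature.AlgebraicTopology.SingularHomology.CupProduct
import HarnessLib

-- provenance: harness21/H21/H21/Prelude/Kaehler/LefschetzOperator.lean @ a332c0f (interim HEAD d8f2665); M5 mechanical rewrite
/-!
# The Lefschetz operator on singular cohomology (outline K7 `LefschetzOperator`)

Given a topological space `X`, a commutative coefficient ring `R` and a degree-2 class
`κ ∈ H²(X; R)`, the *Lefschetz operator* is cup product with `κ`,
`L = κ ⌣ - : Hᵏ(X; R) → Hᵏ⁺²(X; R)`, and its iterates `Lʲ : Hᵏ(X; R) → Hᵏ⁺²ʲ(X; R)`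
(Voisin, *Hodge Theory and Complex Algebraic Geometry I* (2002), §6.2.3; Griffiths–Harris,
*Principles of Algebraic Geometry* (1978), p. 122). For a compact Kähler manifold of complex
dimension `n` with Kähler class `κ`, the Hard Lefschetz theorem asserts that
`Lⁿ⁻ᵏ : Hᵏ → H²ⁿ⁻ᵏ` is an isomorphism for all `k ≤ n` (Voisin I, Thm. 6.25); the *primitive
cohomology* is `Pᵏ = ker (Lⁿ⁻ᵏ⁺¹ : Hᵏ → H²ⁿ⁻ᵏ⁺²)` (Voisin I, Def. 6.24).

**Ownership.** Nothing in this file is Kähler-specific: it is *the* H21 carrier of the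
Lefschetz operator on singular cohomology (notion `hard_lefschetz`, owned by trunk T-MOTIVE /
G17). G17 (standard conjectures, Lefschetz-type statements) must **import this file rather
than redefine** `lefschetzOperator` / `lefschetzPow` / `HasHardLefschetzProperty` /
`lefschetzPrimitive`. The file imports no Kähler module and only the G04 singular-cohomology
prelude, so the supervisor may relocate it verbatim to `Prelude/AlgTop/`.

Mathlib has no Lefschetz operator, hard Lefschetz property or primitive cohomology (searched:
`lefschetz`, `Lefschetz`, `primitive cohomology`); it also has no cup product on singular
cohomology, which is why we build on the H21 G04 prelude `Literature.AlgebraicTopology.SingularHomology.cupProduct`.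

## Design

* Conventions of G04 (`Literature.Prelude.AlgTop.SingularCochains`, `Literature.Prelude.AlgTop.CupProduct`):
  `X : Type u` unbundled with `[TopologicalSpace X]`, `R : Type v` a commutative ring,
  `singularCohomology R R X k : ModuleCat.{max u v} R` (coerced to its carrier), and the cup
  product `cupProduct (h : p + q = n) : Hᵖ →ₗ[R] Hᵠ →ₗ[R] Hⁿ` with degrees tracked by explicit
  equations.
* `lefschetzPow κ j k : Hᵏ →ₗ[R] H^{k + 2 * j}` is defined by structural recursion on `j`; the
  target degree `k + 2 * j` is a closed expression so that no casts between cohomology groups are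
  needed (`k + 2 * 0` reduces to `k` definitionally).
* The hard Lefschetz property in complex dimension `n` is phrased as
  `∀ j k, k + j = n → Bijective (Lʲ : Hᵏ → H^{k + 2j})`; then `k + 2j = 2n - k` automatically and
  no natural-number subtraction appears. Likewise primitive cohomology takes the equation
  `k + j = n + 1` as a hypothesis.

## Main definitions

* `Literature.lefschetzOperator κ h : Hᵏ(X; R) →ₗ[R] Hˡ(X; R)` (`h : 2 + k = l`), `a ↦ κ ⌣ a`.
* `Literature.lefschetzPow κ j k : Hᵏ(X; R) →ₗ[R] H^{k + 2j}(X; R)`, the iterate `Lʲ`.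
* `Literature.HasHardLefschetzProperty κ n : Prop`, hard Lefschetz in (complex) dimension `n`.
* `Literature.lefschetzPrimitive κ h : Submodule R (Hᵏ(X; R))` (`h : k + j = n + 1`), primitive classes.

## Main statements

* `Literature.Geometry.Kaehler.lefschetzPow_zero`, `Literature.Geometry.Kaehler.lefschetzPow_succ` (definitional unfolding, `simp`).
* `Literature.Geometry.Kaehler.lefschetzPow_map`: naturality `f^* ∘ Lʲ_κ = Lʲ_{f^*κ} ∘ f^*` (from `Literature.AlgebraicTopology.SingularHomology.cupProduct_map`,
  Hatcher 2002, Prop. 3.10).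

## References

* C. Voisin, *Hodge Theory and Complex Algebraic Geometry I*, CUP 2002, §6.2.3.
* P. Griffiths, J. Harris, *Principles of Algebraic Geometry*, Wiley 1978, p. 122.
* A. Hatcher, *Algebraic Topology*, CUP 2002, §3.2.
-/

noncomputable section

universe u v

namespace Literature.Geometry.Kaehler

variable {X Y : Type u} [TopologicalSpace X] [TopologicalSpace Y] {R : Type v} [CommRing R]
variable (κ : Literature.AlgebraicTopology.SingularHomology.singularCohomology R R X 2)

/-- The **Lefschetz operator** of a class `κ ∈ H²(X; R)`: cup product on the left with `κ`,
`L a = κ ⌣ a`, `Hᵏ(X; R) → Hˡ(X; R)` with `2 + k = l` (Voisin 2002, §6.2.3; Griffiths–Harris 1978,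
p. 122). [cite: Voisin2002, §6.2.3] -/
def lefschetzOperator {k l : ℕ} (h : 2 + k = l) :
    Literature.AlgebraicTopology.SingularHomology.singularCohomology R R X k →ₗ[R] Literature.AlgebraicTopology.SingularHomology.singularCohomology R R X l :=
  Literature.AlgebraicTopology.SingularHomology.cupProduct h κ

/-- `lefschetzOperator κ h a = κ ⌣ a` (Voisin 2002, §6.2.3). [cite: Voisin2002, §6.2.3] -/
@[simp]
lemma lefschetzOperator_apply {k l : ℕ} (h : 2 + k = l) (a : Literature.AlgebraicTopology.SingularHomology.singularCohomology R R X k) :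
    lefschetzOperator κ h a = Literature.AlgebraicTopology.SingularHomology.cupProduct h κ a :=
  rfl

/-- The iterated Lefschetz operator `Lʲ = (κ ⌣ -)ʲ : Hᵏ(X; R) → H^{k + 2j}(X; R)` of a class
`κ ∈ H²(X; R)`, defined by recursion on `j`: `L⁰ = id`, `Lʲ⁺¹ = L ∘ Lʲ`
(Voisin 2002, §6.2.3; Griffiths–Harris 1978, p. 122). [cite: Voisin2002, §6.2.3] -/
def lefschetzPow : (j k : ℕ) →
    (Literature.AlgebraicTopology.SingularHomology.singularCohomology R R X k →ₗ[R] Literature.AlgebraicTopology.SingularHomology.singularCohomology R R X (k + 2 * j))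
  | 0, _ => LinearMap.id
  | j + 1, k => lefschetzOperator κ (by omega : 2 + (k + 2 * j) = k + 2 * (j + 1)) ∘ₗ
      lefschetzPow j k

/-- `L⁰ = id` (Voisin 2002, §6.2.3). [cite: Voisin2002, §6.2.3] -/
@[simp]
lemma lefschetzPow_zero (k : ℕ) :
    lefschetzPow κ 0 k = (LinearMap.id : Literature.AlgebraicTopology.SingularHomology.singularCohomology R R X k →ₗ[R] _) :=
  rfl

/-- `Lʲ⁺¹ = L ∘ Lʲ` (Voisin 2002, §6.2.3). [cite: Voisin2002, §6.2.3] -/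
@[simp]
lemma lefschetzPow_succ (j k : ℕ) :
    lefschetzPow κ (j + 1) k =
      lefschetzOperator κ (by omega : 2 + (k + 2 * j) = k + 2 * (j + 1)) ∘ₗ lefschetzPow κ j k :=
  rfl

/-- Naturality of the Lefschetz operator under pull-back along a continuous map `f : X → Y`:
`f^*(κ ⌣ a) = f^*κ ⌣ f^*a` (from `cupProduct_map`; Hatcher 2002, Prop. 3.10; Voisin 2002,
§6.2.3). [cite: Hatcher2002, Prop. 3.10] -/
theorem lefschetzOperator_map (f : C(X, Y)) (κ : Literature.AlgebraicTopology.SingularHomology.singularCohomology R R Y 2) {k l : ℕ}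
    (h : 2 + k = l) (a : Literature.AlgebraicTopology.SingularHomology.singularCohomology R R Y k) :
    Literature.AlgebraicTopology.SingularHomology.singularCohomology.map R R f l (lefschetzOperator κ h a) =
      lefschetzOperator (Literature.AlgebraicTopology.SingularHomology.singularCohomology.map R R f 2 κ) h (Literature.AlgebraicTopology.SingularHomology.singularCohomology.map R R f k a) :=
  Literature.AlgebraicTopology.SingularHomology.cupProduct_map f h κ a

/-- Naturality of the iterated Lefschetz operator under pull-back along a continuous map
`f : X → Y`: `f^* ∘ Lʲ_κ = Lʲ_{f^*κ} ∘ f^*` on `Hᵏ(Y; R)` (from `cupProduct_map`; Hatcher 2002,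
Prop. 3.10; Voisin 2002, §6.2.3). [cite: Hatcher2002, Prop. 3.10] -/
theorem lefschetzPow_map (f : C(X, Y)) (κ : Literature.AlgebraicTopology.SingularHomology.singularCohomology R R Y 2) (j k : ℕ)
    (a : Literature.AlgebraicTopology.SingularHomology.singularCohomology R R Y k) :
    Literature.AlgebraicTopology.SingularHomology.singularCohomology.map R R f (k + 2 * j) (lefschetzPow κ j k a) =
      lefschetzPow (Literature.AlgebraicTopology.SingularHomology.singularCohomology.map R R f 2 κ) j k (Literature.AlgebraicTopology.SingularHomology.singularCohomology.map R R f k a) := by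
  induction j with
  | zero => rfl
  | succ j ih =>
    simp only [lefschetzPow_succ, LinearMap.comp_apply]
    rw [lefschetzOperator_map, ih]

/-- The **hard Lefschetz property** of a class `κ ∈ H²(X; R)` in (complex) dimension `n`: for all
`j`, `k` with `k + j = n`, the iterate `Lʲ = Lⁿ⁻ᵏ : Hᵏ(X; R) → H^{k + 2j}(X; R) = H^{2n - k}(X; R)`
is bijective (Voisin 2002, Thm. 6.25; Griffiths–Harris 1978, p. 122). Phrased with the equation
`k + j = n` so that no natural-number subtraction occurs. [cite: Voisin2002, Thm. 6.25] -/
def HasHardLefschetzProperty (n : ℕ) : Prop :=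
  ∀ j k : ℕ, k + j = n → Function.Bijective (lefschetzPow κ j k)

/-- The **primitive cohomology** `Pᵏ = ker (Lⁿ⁻ᵏ⁺¹ : Hᵏ(X; R) → H^{2n - k + 2}(X; R))` of a class
`κ ∈ H²(X; R)` in (complex) dimension `n`, for `k + j = n + 1` (Voisin 2002, Def. 6.24;
Griffiths–Harris 1978, p. 122), as an `R`-submodule of `Hᵏ(X; R)`. The hypothesis `h` only fixes
the exponent `j = n + 1 - k` without subtraction. [cite: Voisin2002, Def. 6.24] -/
def lefschetzPrimitive {k j n : ℕ} (_h : k + j = n + 1) :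
    Submodule R (Literature.AlgebraicTopology.SingularHomology.singularCohomology R R X k) :=
  LinearMap.ker (lefschetzPow κ j k)

/-- Membership in primitive cohomology: `a ∈ Pᵏ ↔ Lʲ a = 0`, `k + j = n + 1`
(Voisin 2002, Def. 6.24). [cite: Voisin2002, Def. 6.24] -/
@[simp]
lemma mem_lefschetzPrimitive {k j n : ℕ} (h : k + j = n + 1) (a : Literature.AlgebraicTopology.SingularHomology.singularCohomology R R X k) :
    a ∈ lefschetzPrimitive κ h ↔ lefschetzPow κ j k a = 0 :=
  LinearMap.mem_ker

end Literature.Geometry.Kaehler
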